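import Mathlib
import HarnessLib
import Literature.MathematicalPhysics.QuantumLattice.FermiRG.BGM2006AppA
import Summits.HubbardSuperconductivity.HubbardSuperconductivity.Theorems.KLProgrammeH10TwoPointLimitOffsetSectorCount
import Summits.HubbardSuperconductivity.HubbardSuperconductivity.Theorems.KLProgrammeH10TwoPointLimitPerturbedShell

/-!
# Route `KLProgramme` — crux K1 `H10TwoPointLimit` (stmt-HubbardSuperconductivity-19938): the endpoint sector sum (BGM 2006 (2.96))
# modulo `2πℤ²` over BGM's typed s-sectors — input (E) of Paper 1's Theorem 2.1

`offsetSectorCount_slack` (Cor. F.3 with slack) counts grid-index triples (`sectorIndex n`, width `w_n = π/2ⁿ`) admitting shell momenta with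
`|P₀ + k₂ + k₃ + k₄ - 2πG|_∞ ≤ cS·w_n`, uniformly in `P₀, G`: `≤ K 2ⁿ(n+1)`. BGM's endpoint sums (2.96) run over their ANISOTROPIC s-sectors
`S_{h,ω}` ((2.69); typed as `FermiRG.BGM2006AppA.sSector`: angular partition `ζ_{n,ω} = sectorWeightCirc n ω`, radial shell `4^h e₀`). Transfer:
an s-sector momentum of the square has grid index within `±1 (mod |O_h|)` of the s-sector index (`exists_shift_eq_sectorIndex`), so the s-sector
triples admitting momenta inject, after one of `27` cyclic shifts, into the grid triples: **`bgm_endpoint_count_le`** `≤ 27 K 2ⁿ (n+1) = C γ^{-h/2}|h|`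
for every `e₀ ∈ [0, π]`, uniformly in `P₀` (the anchored leg, known up to `cS·w_n`) and `G`; charges `Σ εⱼ kⱼ` by the antipodal relabelling
`S_{h,ω+2ⁿ} = -S_{h,ω}` (`sectorWeightCirc_antipode`, `neg_mem_sSector_antipode`, **`bgm_endpoint_count_signed_le`**); and the moving curve:
**`offsetSectorCount_perturbed`** (any `E` with `sup_square |E - ε₀| ≤ w_n/2`, by `shell_of_perturbed`). With `…SectorCountBGM.lean` (input (V)) and
`CountPairsOffset` (input (F)) this completes, in BGM's vocabulary and modulo `2πℤ²`, the sector-counting input of Paper 1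
(HOME/prover-p4/COUNTING-NOTE-2.md §5(b′), SECTOR-COUNTING-INTERFACE.md). In print the «last leg determined» counts are Feldman–Knörrer–Trubowitz,
Single Scale Analysis Part 4, Lemma XXI.4 (ii) (lattice-safe); the anchored `(L-3)/2` count is XXI.4 (iii) (ℝ² only, Prop. XX.5 (ii)) — HOME/LIT-A31-FKT4.md.
Everything is proved; no definitions, no named facts. [cite: BenfattoGiulianiMastropietro2006] [cite: FeldmanKnorrerTrubowitz2003SectorCounting, Lemma XXI.4]
-/

noncomputable section

namespace Summit.HubbardSuperconductivity.HubbardSuperconductivity.Theorems.RelativeSectorCount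

set_option linter.dupNamespace false -- summit = problem name (single-conjunct summit), D-0017

open Classical
open Real Set
open Literature.MathematicalPhysics.QuantumLattice Literature.MathematicalPhysics.QuantumLattice.BandSectorCounting
open Literature.MathematicalPhysics.QuantumLattice.FermiRG.BGM2006AppA (sSector anisoCount scaleIdx)

/-- `scaleIdx (-n) = n`. [folklore] -/
theorem scaleIdx_neg_natCast (n : ℕ) : scaleIdx (-(n : ℤ)) = n := by
  rw [show scaleIdx (-(n : ℤ)) = (-(-(n : ℤ))).toNat from rfl, neg_neg, Int.toNat_natCast]

/-- A shift of `[0, N)` modulo `N` is injective. [folklore] -/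
theorem shift_mod_injective {N c : ℕ} {x y : ℕ} (hx : x < N) (hy : y < N)
    (h : (x + c) % N = (y + c) % N) : x = y := by
  have hN : 0 < N := lt_of_le_of_lt (Nat.zero_le _) hx
  have h1 : x % N = y % N := by
    have := Nat.ModEq.add_right_cancel' c h
    exact this
  rwa [Nat.mod_eq_of_lt hx, Nat.mod_eq_of_lt hy] at h1

/-- **An s-sector momentum has grid index within `±1 (mod |O_h|)` of the s-sector index**: if `ζ_{n,ω}(θ(k)) ≠ 0` then
`(ω + (N - 1) + e) mod N = sectorIndex n (arg(k₁ + ik₂))` for some `e ∈ {0,1,2}`, `N = sectorCount n`. [cite: BenfattoGiulianiMastropietro2006, §2.5 (2.45)–(2.46)] -/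
theorem exists_shift_eq_sectorIndex {n : ℕ} {ω : ℕ} (hω : ω < sectorCount n) {k : Fin 2 → ℝ}
    (hζ : sectorWeightCirc n (ω : ℤ) (polarAngle k) ≠ 0) :
    ∃ e : ℕ, e ≤ 2 ∧ (ω + (sectorCount n - 1) + e) % sectorCount n = sectorIndex n (Complex.arg (⟨k 0, k 1⟩ : ℂ)) := by
  set N := sectorCount n with hNdef
  set w := sectorWidth n with hw
  have hwpos : 0 < w := sectorWidth_pos n
  have hNw : (N : ℝ) * w = 2 * π := sectorCount_mul_sectorWidth n
  have hang : ∃ j : ℤ, |polarAngle k - ((ω : ℝ) + 1 / 2) * w - 2 * π * j| < 3 * w / 4 := by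
    by_contra hc
    push Not at hc
    exact hζ (sectorWeightCirc_eq_zero (by exact_mod_cast hc))
  obtain ⟨j, hj⟩ := hang
  set ι := sectorIndex n (Complex.arg (⟨k 0, k 1⟩ : ℂ)) with hι
  have hιlt : ι < N := sectorIndex_lt n _
  obtain ⟨m, hm⟩ := exists_angleRep_eq_add (Complex.arg (⟨k 0, k 1⟩ : ℂ))
  have harc := mem_sectorArc_sectorIndex n (Complex.arg (⟨k 0, k 1⟩ : ℂ))
  rw [← hι, hm] at harc
  have hpol : polarAngle k = Complex.arg (⟨k 0, k 1⟩ : ℂ) := by rw [polarAngle, momToComplex_eq_mk]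
  rw [hpol] at hj
  set z : ℤ := (ω : ℤ) - ι + (j + m) * N with hz
  have hzw : |(z : ℝ) * w| < 5 * w / 4 := by
    have e1 : (z : ℝ) * w = ((ω : ℝ) + 1 / 2) * w + 2 * π * j + (m : ℝ) * (2 * π) - (ι : ℝ) * w - w / 2 := by
      rw [hz]; push_cast; rw [← hNw]; ring
    rw [e1, abs_lt]
    have h1 := (abs_lt.1 hj).1
    have h2 := (abs_lt.1 hj).2
    constructor <;> nlinarith [harc.1, harc.2]
  have hzabs : |(z : ℝ)| < 5 / 4 := by
    rw [abs_mul, abs_of_pos hwpos] at hzw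
    by_contra hc
    push Not at hc
    have : 5 / 4 * w ≤ |(z : ℝ)| * w := mul_le_mul_of_nonneg_right hc hwpos.le
    linarith
  have hz1 : z ≤ 1 := by
    have h : (z : ℝ) < 2 := by linarith [(abs_lt.1 hzabs).2]
    have h' : z < 2 := by exact_mod_cast h
    omega
  have hz2 : -1 ≤ z := by
    have : (-2 : ℝ) < z := by linarith [(abs_lt.1 hzabs).1]
    have : (-2 : ℤ) < z := by exact_mod_cast this
    omega
  refine ⟨(1 - z).toNat, by omega, ?_⟩
  have hNpos : 0 < N := lt_of_le_of_lt (Nat.zero_le _) hιlt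
  have hq : 0 ≤ 1 - (j + m) := by
    by_contra hc
    push Not at hc
    have hid : ((ω : ℤ) + ((N : ℕ) - 1 : ℕ) + ((1 - z).toNat : ℕ)) = (ι : ℤ) + (1 - (j + m)) * N := by
      rw [Int.toNat_of_nonneg (by omega)]
      rw [Nat.cast_sub (by omega : 1 ≤ N)]
      push_cast; rw [hz]; ring
    have hneg : (ι : ℤ) + (1 - (j + m)) * N < 0 := by
      have : (1 - (j + m)) * (N : ℤ) ≤ -1 * N := mul_le_mul_of_nonneg_right (by omega) (by positivity)
      have hιN : (ι : ℤ) < N := by exact_mod_cast hιlt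
      linarith
    have hnonneg : (0 : ℤ) ≤ (ω : ℤ) + ((N : ℕ) - 1 : ℕ) + ((1 - z).toNat : ℕ) := by positivity
    linarith
  have hid : ω + (N - 1) + (1 - z).toNat = ι + (1 - (j + m)).toNat * N := by
    have h1 : ((ω + (N - 1) + (1 - z).toNat : ℕ) : ℤ) = ((ι + (1 - (j + m)).toNat * N : ℕ) : ℤ) := by
      push_cast
      rw [Int.toNat_of_nonneg (by omega), Int.toNat_of_nonneg hq, Nat.cast_sub (by omega : 1 ≤ N)]
      push_cast; rw [hz]; ring
    exact_mod_cast h1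
  rw [hid, Nat.add_mul_mod_self_right, Nat.mod_eq_of_lt hιlt]

/-- **Antipodal sector weights**: `ζ_{n,ω+2ⁿ}(θ + π) = ζ_{n,ω}(θ)` (`2ⁿ w_n = π`: the sector opposite to `ω` is `ω + 2ⁿ = ω + |O_h|/2`).
[cite: BenfattoGiulianiMastropietro2006, §2.5 (2.45)] -/
theorem sectorWeightCirc_antipode (n : ℕ) (ω : ℤ) (θ : ℝ) :
    sectorWeightCirc n (ω + 2 ^ n) (θ + π) = sectorWeightCirc n ω θ := by
  unfold sectorWeightCirc
  refine tsum_congr fun k => ?_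
  simp only [sectorWeight]
  congr 1
  have hw : sectorWidth n ≠ 0 := (sectorWidth_pos n).ne'
  have hπw : π / sectorWidth n = 2 ^ n := by
    rw [sectorWidth]; field_simp
  push_cast
  rw [add_div, hπw]
  ring

/-- **The polar angle of `-k⃗` is the polar angle of `k⃗` plus `π`, as seen by the (2π-periodic) sector weights.** [folklore] -/
theorem sectorWeightCirc_polarAngle_neg (n : ℕ) (ω : ℤ) {k : Fin 2 → ℝ} (hk : k ≠ 0) :
    sectorWeightCirc n ω (polarAngle (-k)) = sectorWeightCirc n ω (polarAngle k + π) := by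
  have hz : momToComplex k ≠ 0 := fun h => hk ((momToComplex_eq_zero_iff k).1 h)
  have hneg : momToComplex (-k) = -momToComplex k := by
    rw [momToComplex_eq_mk, momToComplex_eq_mk]
    apply Complex.ext <;> simp
  have hang : ((Complex.arg (-momToComplex k) : Real.Angle)) = (Complex.arg (momToComplex k) : Real.Angle) + (π : Real.Angle) :=
    Complex.arg_neg_coe_angle hz
  rw [← Real.Angle.coe_add, Real.Angle.angle_eq_iff_two_pi_dvd_sub] at hang
  obtain ⟨m, hm⟩ := hang
  rw [polarAngle, polarAngle, hneg]
  have : Complex.arg (-momToComplex k) = Complex.arg (momToComplex k) + π + m * (2 * π) := by linarith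
  rw [this]
  exact (periodic_sectorWeightCirc n ω).int_mul m _

/-- **Antipodal s-sectors**: `k ∈ S_{h,ω}` iff `-k ∈ S_{h,ω+2ⁿ}` (free Hubbard family; `ε₀` is even). [cite: BenfattoGiulianiMastropietro2006, §2.7 (2.69)] -/
theorem neg_mem_sSector_antipode {e₀ μ : ℝ} {h : ℤ} {ω : ℕ} {k : Fin 2 → ℝ} (hk : k ≠ 0)
    (hmem : k ∈ sSector 4 e₀ μ (fun _ => sqDispersion) h ω) :
    -k ∈ sSector 4 e₀ μ (fun _ => sqDispersion) h (ω + 2 ^ scaleIdx h) := by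
  obtain ⟨hshell, hζ⟩ := hmem
  refine ⟨?_, ?_⟩
  · have hev : sqDispersion (-k) = sqDispersion k := by simp [sqDispersion, Real.cos_neg]
    show |sqDispersion (-k) - μ| ≤ (4 : ℝ) ^ h * e₀
    rw [hev]; exact hshell
  · rw [sectorWeightCirc_polarAngle_neg _ _ hk]
    push_cast
    rw [sectorWeightCirc_antipode]
    exact hζ

/-- **The endpoint sector sum (2.96) over BGM's s-sectors, modulo `2πℤ²`** (input (E)): for every window and slack `cS ≥ 0` there is `K`
such that for every `μ`, scale `n` (`h = -n`), `e₀ ∈ [0, π]`, class `G` and offset `P₀` (the anchored leg, known up to `cS·w_n`), the number of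
triples `(ω₂, ω₃, ω₄) ∈ O_h³` admitting momenta of the open square `kⱼ ∈ S_{h,ωⱼ}` with `|P₀ + k₂ + k₃ + k₄ - 2πG|_∞ ≤ cS·w_n` is
`≤ 27 K 2ⁿ (n+1) = C γ^{-h/2}|h|` (BGM's `cγ^{-h₀/2}` up to the `|h|` that `c₀` pays). [cite: BenfattoGiulianiMastropietro2006, §2.8 (2.96), App. A2] -/
theorem bgm_endpoint_count_le :
    ∀ μ₁ μ₂ cS : ℝ, -4 < μ₁ → μ₁ ≤ μ₂ → μ₂ < 0 → 0 ≤ cS → ∃ K : ℝ, 0 < K ∧ ∀ μ ∈ Set.Icc μ₁ μ₂, ∀ (n : ℕ) (e₀ : ℝ), 0 ≤ e₀ → e₀ ≤ π →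
      ∀ (G : Fin 2 → ℤ) (P₀ : Fin 2 → ℝ),
      (((Finset.univ : Finset (Fin (sectorCount n) × Fin (sectorCount n) × Fin (sectorCount n))).filter
        (fun ω : Fin (sectorCount n) × Fin (sectorCount n) × Fin (sectorCount n) =>
        ∃ k : Fin 3 → Fin 2 → ℝ, (∀ j i, |k j i| < Real.pi) ∧
          k 0 ∈ sSector 4 e₀ μ (fun _ => sqDispersion) (-(n : ℤ)) (ω.1 : ℕ) ∧
          k 1 ∈ sSector 4 e₀ μ (fun _ => sqDispersion) (-(n : ℤ)) (ω.2.1 : ℕ) ∧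
          k 2 ∈ sSector 4 e₀ μ (fun _ => sqDispersion) (-(n : ℤ)) (ω.2.2 : ℕ) ∧
          (∀ i, |P₀ i + ∑ j, k j i - 2 * Real.pi * (G i : ℝ)| ≤ cS * sectorWidth n))).card : ℝ) ≤
        27 * K * 2 ^ n * ((n : ℝ) + 1) := by
  intro μ₁ μ₂ cS hμ₁ h12 hμ₂ hc
  obtain ⟨K, hK, hcount⟩ := offsetSectorCount_slack μ₁ μ₂ cS hμ₁ h12 hμ₂ hc
  refine ⟨K, hK, fun μ hμ n e₀ he0 heπ G P₀ => ?_⟩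
  set N := sectorCount n with hNdef
  have hNpos : 0 < N := by rw [hNdef, sectorCount]; positivity
  have hshell : (4 : ℝ) ^ (-(n : ℤ)) * e₀ ≤ sectorWidth n := by
    rw [zpow_neg, zpow_natCast, sectorWidth]
    rw [show ((4 : ℝ) ^ n)⁻¹ * e₀ = e₀ / 4 ^ n by ring]
    have h42 : (2 : ℝ) ^ n ≤ 4 ^ n := pow_le_pow_left₀ (by norm_num) (by norm_num) n
    have h2pos : (0 : ℝ) < 2 ^ n := by positivity
    calc e₀ / 4 ^ n ≤ e₀ / 2 ^ n := div_le_div_of_nonneg_left he0 h2pos h42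
      _ ≤ π / 2 ^ n := div_le_div_of_nonneg_right heπ h2pos.le
  set A : Finset (Fin N × Fin N × Fin N) := (Finset.univ.filter fun ω : Fin N × Fin N × Fin N =>
      ∃ k : Fin 3 → Fin 2 → ℝ, (∀ j i, |k j i| < Real.pi) ∧ (∀ j, |sqDispersion (k j) - μ| ≤ sectorWidth n) ∧
        sectorIndex n (Complex.arg (⟨k 0 0, k 0 1⟩ : ℂ)) = (ω.1 : ℕ) ∧
        sectorIndex n (Complex.arg (⟨k 1 0, k 1 1⟩ : ℂ)) = (ω.2.1 : ℕ) ∧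
        sectorIndex n (Complex.arg (⟨k 2 0, k 2 1⟩ : ℂ)) = (ω.2.2 : ℕ) ∧
        (∀ i, |P₀ i + ∑ j, k j i - 2 * Real.pi * (G i : ℝ)| ≤ cS * sectorWidth n)) with hA
  have hAcard : ((A.card : ℕ) : ℝ) ≤ K * 2 ^ n * ((n : ℝ) + 1) := hcount μ hμ n G P₀
  set sh : ℕ → Fin N → Fin N := fun e ω => ⟨((ω : ℕ) + (N - 1) + e) % N, Nat.mod_lt _ hNpos⟩ with hsh
  have hsh_inj : ∀ e, Function.Injective (sh e) := by
    intro e x y hxy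
    rw [hsh] at hxy
    simp only [Fin.mk.injEq] at hxy
    have := shift_mod_injective (c := (N - 1) + e) x.2 y.2 (by simpa [add_assoc] using hxy)
    exact Fin.ext this
  set SH : ℕ × ℕ × ℕ → (Fin N × Fin N × Fin N) → (Fin N × Fin N × Fin N) :=
    fun e ω => (sh e.1 ω.1, sh e.2.1 ω.2.1, sh e.2.2 ω.2.2) with hSH
  have hSH_inj : ∀ e, Function.Injective (SH e) := by
    intro e x y hxy
    rw [hSH] at hxy
    simp only [Prod.mk.injEq] at hxy
    exact Prod.ext (hsh_inj _ hxy.1) (Prod.ext (hsh_inj _ hxy.2.1) (hsh_inj _ hxy.2.2))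
  set E3 : Finset (ℕ × ℕ × ℕ) := Finset.range 3 ×ˢ (Finset.range 3 ×ˢ Finset.range 3) with hE3
  have hsub : (Finset.univ.filter fun ω : Fin N × Fin N × Fin N =>
        ∃ k : Fin 3 → Fin 2 → ℝ, (∀ j i, |k j i| < Real.pi) ∧
          k 0 ∈ sSector 4 e₀ μ (fun _ => sqDispersion) (-(n : ℤ)) (ω.1 : ℕ) ∧
          k 1 ∈ sSector 4 e₀ μ (fun _ => sqDispersion) (-(n : ℤ)) (ω.2.1 : ℕ) ∧
          k 2 ∈ sSector 4 e₀ μ (fun _ => sqDispersion) (-(n : ℤ)) (ω.2.2 : ℕ) ∧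
          (∀ i, |P₀ i + ∑ j, k j i - 2 * Real.pi * (G i : ℝ)| ≤ cS * sectorWidth n)) ⊆
      E3.biUnion (fun e => Finset.univ.filter fun ω : Fin N × Fin N × Fin N => SH e ω ∈ A) := by
    intro ω hω
    rw [Finset.mem_filter] at hω
    obtain ⟨-, k, hk, h0, h1, h2, hsum⟩ := hω
    have hs : ∀ j, k j ∈ sSector 4 e₀ μ (fun _ => sqDispersion) (-(n : ℤ))
        ((![ω.1, ω.2.1, ω.2.2] : Fin 3 → Fin N) j : ℕ) := by
      intro j; fin_cases j
      · simpa using h0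
      · simpa using h1
      · simpa using h2
    have hsh' : ∀ j, |sqDispersion (k j) - μ| ≤ sectorWidth n := fun j => (hs j).1.trans hshell
    have hidx : ∀ j, ∃ e : ℕ, e ≤ 2 ∧ (((![ω.1, ω.2.1, ω.2.2] : Fin 3 → Fin N) j : ℕ) + (N - 1) + e) % N =
        sectorIndex n (Complex.arg (⟨k j 0, k j 1⟩ : ℂ)) := by
      intro j
      have hmem := hs j
      have hζ := hmem.2
      rw [scaleIdx_neg_natCast] at hζ
      exact exists_shift_eq_sectorIndex (((![ω.1, ω.2.1, ω.2.2] : Fin 3 → Fin N) j).2) hζ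
    obtain ⟨e0, he0', hι0⟩ := hidx 0
    obtain ⟨e1, he1', hι1⟩ := hidx 1
    obtain ⟨e2, he2', hι2⟩ := hidx 2
    rw [Finset.mem_biUnion]
    refine ⟨(e0, e1, e2), ?_, ?_⟩
    · rw [hE3]; simp only [Finset.mem_product, Finset.mem_range]; omega
    · rw [Finset.mem_filter]
      refine ⟨Finset.mem_univ _, ?_⟩
      rw [hA, Finset.mem_filter]
      refine ⟨Finset.mem_univ _, k, hk, hsh', ?_, ?_, ?_, hsum⟩
      · simpa [hSH, hsh] using hι0.symm
      · simpa [hSH, hsh] using hι1.symm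
      · simpa [hSH, hsh] using hι2.symm
  -- count
  have hE3card : E3.card = 27 := by rw [hE3]; simp
  have hpiece : ∀ e, ((Finset.univ.filter fun ω : Fin N × Fin N × Fin N => SH e ω ∈ A).card : ℕ) ≤ A.card := by
    intro e
    exact Finset.card_le_card_of_injOn (SH e) (fun ω hω => by
      rw [Finset.mem_coe, Finset.mem_filter] at hω
      rw [Finset.mem_coe]; exact hω.2) ((hSH_inj e).injOn)
  calc _ ≤ (((E3.biUnion (fun e => Finset.univ.filter fun ω : Fin N × Fin N × Fin N => SH e ω ∈ A)).card : ℕ) : ℝ) := by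
        exact_mod_cast Finset.card_le_card hsub
    _ ≤ ((∑ e ∈ E3, (Finset.univ.filter fun ω : Fin N × Fin N × Fin N => SH e ω ∈ A).card : ℕ) : ℝ) := by
        exact_mod_cast Finset.card_biUnion_le
    _ ≤ ((∑ _e ∈ E3, A.card : ℕ) : ℝ) := by exact_mod_cast Finset.sum_le_sum fun e _ => hpiece e
    _ = 27 * (A.card : ℝ) := by simp [Finset.sum_const, hE3card]
    _ ≤ 27 * (K * 2 ^ n * ((n : ℝ) + 1)) := by gcongr
    _ = 27 * K * 2 ^ n * ((n : ℝ) + 1) := by ring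

/-- **The endpoint sector sum with charges** (`Σ εⱼ kⱼ`, `εⱼ = ±`): reduces to `bgm_endpoint_count_le` by the antipodal relabelling
`ω ↦ ω + 2ⁿ (mod |O_h|)` of the negatively charged legs (`-S_{h,ω} = S_{h,ω+2ⁿ}`), an injection of index triples. Requires
`e₀ < 4 + μ₁` (then shell momenta are nonzero, so polar angles are defined up to `2π`). [cite: BenfattoGiulianiMastropietro2006, §2.8 (2.96)] -/
theorem bgm_endpoint_count_signed_le :
    ∀ μ₁ μ₂ cS : ℝ, -4 < μ₁ → μ₁ ≤ μ₂ → μ₂ < 0 → 0 ≤ cS → ∃ K : ℝ, 0 < K ∧ ∀ μ ∈ Set.Icc μ₁ μ₂, ∀ (n : ℕ) (e₀ : ℝ), 0 ≤ e₀ → e₀ ≤ π →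
      e₀ < 4 + μ₁ → ∀ (σ : Fin 3 → Bool) (G : Fin 2 → ℤ) (P₀ : Fin 2 → ℝ),
      (((Finset.univ : Finset (Fin (sectorCount n) × Fin (sectorCount n) × Fin (sectorCount n))).filter
        (fun ω : Fin (sectorCount n) × Fin (sectorCount n) × Fin (sectorCount n) =>
        ∃ k : Fin 3 → Fin 2 → ℝ, (∀ j i, |k j i| < Real.pi) ∧
          k 0 ∈ sSector 4 e₀ μ (fun _ => sqDispersion) (-(n : ℤ)) (ω.1 : ℕ) ∧
          k 1 ∈ sSector 4 e₀ μ (fun _ => sqDispersion) (-(n : ℤ)) (ω.2.1 : ℕ) ∧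
          k 2 ∈ sSector 4 e₀ μ (fun _ => sqDispersion) (-(n : ℤ)) (ω.2.2 : ℕ) ∧
          (∀ i, |P₀ i + ∑ j, (if σ j then k j i else -k j i) - 2 * Real.pi * (G i : ℝ)| ≤ cS * sectorWidth n))).card : ℝ) ≤
        27 * K * 2 ^ n * ((n : ℝ) + 1) := by
  intro μ₁ μ₂ cS hμ₁ h12 hμ₂ hc
  obtain ⟨K, hK, hcount⟩ := bgm_endpoint_count_le μ₁ μ₂ cS hμ₁ h12 hμ₂ hc
  refine ⟨K, hK, fun μ hμ n e₀ he0 heπ he4 σ G P₀ => le_trans ?_ (hcount μ hμ n e₀ he0 heπ G P₀)⟩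
  set N := sectorCount n with hNdef
  have hNpos : 0 < N := by rw [hNdef, sectorCount]; positivity
  have hNeq : N = 2 ^ n + 2 ^ n := by rw [hNdef, sectorCount, pow_succ]; ring
  -- shell momenta are nonzero
  have hne : ∀ {k : Fin 2 → ℝ} {ω : ℕ}, k ∈ sSector 4 e₀ μ (fun _ => sqDispersion) (-(n : ℤ)) ω → k ≠ 0 := by
    intro k ω hk h0
    have hsh : |sqDispersion k - μ| ≤ (4 : ℝ) ^ (-(n : ℤ)) * e₀ := hk.1
    rw [h0, sqDispersion_zero] at hsh
    have h4 : (4 : ℝ) ^ (-(n : ℤ)) * e₀ ≤ e₀ := by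
      rw [zpow_neg, zpow_natCast]
      have : ((4 : ℝ) ^ n)⁻¹ ≤ 1 := inv_le_one_of_one_le₀ (one_le_pow₀ (by norm_num))
      nlinarith
    have : |(-4 : ℝ) - μ| = 4 + μ := by rw [abs_of_neg (by linarith [hμ.1, hμ₁])]; ring
    linarith [hμ.1]
  -- the antipodal relabelling of one index
  set r : Bool → Fin N → Fin N := fun b ω => if b then ω else ⟨((ω : ℕ) + 2 ^ n) % N, Nat.mod_lt _ hNpos⟩ with hr
  have hr_inj : ∀ b, Function.Injective (r b) := by
    intro b x y hxy
    rw [hr] at hxy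
    cases b
    · simp only [Bool.false_eq_true, ↓reduceIte, Fin.mk.injEq] at hxy
      exact Fin.ext (shift_mod_injective x.2 y.2 hxy)
    · simpa using hxy
  -- relabelled momenta stay in the relabelled s-sectors
  have hmemr : ∀ (b : Bool) (ω : Fin N) (k : Fin 2 → ℝ), k ∈ sSector 4 e₀ μ (fun _ => sqDispersion) (-(n : ℤ)) (ω : ℕ) →
      (if b then k else -k) ∈ sSector 4 e₀ μ (fun _ => sqDispersion) (-(n : ℤ)) ((r b ω : Fin N) : ℕ) := by
    intro b ω k hk
    cases b
    · simp only [Bool.false_eq_true, ↓reduceIte, hr]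
      have hanti := neg_mem_sSector_antipode (hne hk) hk
      rw [scaleIdx_neg_natCast] at hanti
      -- reduce the index `ω + 2ⁿ` modulo `N`
      by_cases hlt : (ω : ℕ) + 2 ^ n < N
      · rw [Nat.mod_eq_of_lt hlt]; exact hanti
      · have hge : N ≤ (ω : ℕ) + 2 ^ n := not_lt.1 hlt
        have hlt2 : (ω : ℕ) + 2 ^ n < N + N := by have := ω.2; omega
        have hmod : ((ω : ℕ) + 2 ^ n) % N = (ω : ℕ) + 2 ^ n - N := by
          rw [Nat.mod_eq_sub_mod hge, Nat.mod_eq_of_lt (by omega)]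
        rw [hmod]
        refine ⟨hanti.1, ?_⟩
        have hζ := hanti.2
        have hcastsub : (((ω : ℕ) + 2 ^ n - N : ℕ) : ℤ) = ((ω : ℕ) : ℤ) + 2 ^ n - N := by
          push_cast [Nat.cast_sub hge]; ring
        have hidx : (((ω : ℕ) + 2 ^ n : ℕ) : ℤ) = (((ω : ℕ) + 2 ^ n - N : ℕ) : ℤ) + (sectorCount n : ℤ) := by
          rw [hcastsub, show ((sectorCount n : ℕ) : ℤ) = (N : ℤ) from rfl]; push_cast; ring
        rw [scaleIdx_neg_natCast] at hζ ⊢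
        rw [hidx, sectorWeightCirc_add_sectorCount] at hζ
        exact hζ
    · simpa [hr] using hk
  set R : (Fin N × Fin N × Fin N) → (Fin N × Fin N × Fin N) := fun ω => (r (σ 0) ω.1, r (σ 1) ω.2.1, r (σ 2) ω.2.2) with hR
  have hR_inj : Function.Injective R := by
    intro x y hxy
    rw [hR] at hxy
    simp only [Prod.mk.injEq] at hxy
    exact Prod.ext (hr_inj _ hxy.1) (Prod.ext (hr_inj _ hxy.2.1) (hr_inj _ hxy.2.2))
  have hmaps : Set.MapsTo R
      (((Finset.univ : Finset (Fin N × Fin N × Fin N)).filter fun ω : Fin N × Fin N × Fin N =>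
        ∃ k : Fin 3 → Fin 2 → ℝ, (∀ j i, |k j i| < Real.pi) ∧
          k 0 ∈ sSector 4 e₀ μ (fun _ => sqDispersion) (-(n : ℤ)) (ω.1 : ℕ) ∧
          k 1 ∈ sSector 4 e₀ μ (fun _ => sqDispersion) (-(n : ℤ)) (ω.2.1 : ℕ) ∧
          k 2 ∈ sSector 4 e₀ μ (fun _ => sqDispersion) (-(n : ℤ)) (ω.2.2 : ℕ) ∧
          (∀ i, |P₀ i + ∑ j, (if σ j then k j i else -k j i) - 2 * Real.pi * (G i : ℝ)| ≤ cS * sectorWidth n)) :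
        Set (Fin N × Fin N × Fin N))
      (((Finset.univ : Finset (Fin N × Fin N × Fin N)).filter fun ω : Fin N × Fin N × Fin N =>
        ∃ k : Fin 3 → Fin 2 → ℝ, (∀ j i, |k j i| < Real.pi) ∧
          k 0 ∈ sSector 4 e₀ μ (fun _ => sqDispersion) (-(n : ℤ)) (ω.1 : ℕ) ∧
          k 1 ∈ sSector 4 e₀ μ (fun _ => sqDispersion) (-(n : ℤ)) (ω.2.1 : ℕ) ∧
          k 2 ∈ sSector 4 e₀ μ (fun _ => sqDispersion) (-(n : ℤ)) (ω.2.2 : ℕ) ∧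
          (∀ i, |P₀ i + ∑ j, k j i - 2 * Real.pi * (G i : ℝ)| ≤ cS * sectorWidth n)) :
        Set (Fin N × Fin N × Fin N)) := by
    intro ω hω
    rw [Finset.mem_coe, Finset.mem_filter] at hω ⊢
    obtain ⟨-, k, hk, h0, h1, h2, hsum⟩ := hω
    refine ⟨Finset.mem_univ _, fun j => if σ j then k j else -k j, ?_, ?_, ?_, ?_, ?_⟩
    · intro j i; by_cases hj : σ j <;> simp [hj, abs_neg, hk j i]
    · simpa [hR] using hmemr (σ 0) _ _ h0
    · simpa [hR] using hmemr (σ 1) _ _ h1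
    · simpa [hR] using hmemr (σ 2) _ _ h2
    · intro i
      have e : ∑ j, (fun j => if σ j then k j else -k j) j i = ∑ j, (if σ j then k j i else -k j i) := by
        refine Finset.sum_congr rfl fun j _ => ?_
        by_cases hj : σ j <;> simp [hj]
      rw [e]; exact hsum i
  exact_mod_cast Finset.card_le_card_of_injOn R hmaps hR_inj.injOn

end Summit.HubbardSuperconductivity.HubbardSuperconductivity.Theorems.RelativeSectorCount

namespace Summit.HubbardSuperconductivity.HubbardSuperconductivity.Theorems

open Classical
open Real Set
open Literature.MathematicalPhysics.QuantumLattice Literature.MathematicalPhysics.QuantumLattice.BandSectorCounting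
open Summit.HubbardSuperconductivity.HubbardSuperconductivity.Theorems.RelativeSectorCount

set_option linter.dupNamespace false in -- summit = problem name (single-conjunct summit), D-0017
/-- **Cor. F.3 for a perturbed dispersion** (input (E) of Paper 1's Theorem 2.1 on the moving curve; GAP-LEDGER G-002 closed by
shell inclusion): for every level window and slack `cS ≥ 0` there is `K` such that for every `μ`, scale `n` (`w_n = π/2ⁿ`),
reciprocal vector `2πG`, offset `P₀`, and EVERY function `E` on the square with `sup_square |E - ε₀| ≤ w_n/2` (BGM (2.36):
`sup |E_h - ε₀| ≤ C|U||h|γ^{2h} ≤ γ^h/2`), the number of sector triples admitting momenta of the `E`-shell `|E - μ| ≤ w_n/2` with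
`|P₀ + k₂ + k₃ + k₄ - 2πG|_∞ ≤ cS·w_n` is `≤ K 2ⁿ (n+1)` — the same `K` as for the free shell `|ε₀ - μ| ≤ w_n`
(`offsetSectorCount_slack`). [cite: BenfattoGiulianiMastropietro2006, App. A2, §2.4 (2.36)] -/
theorem offsetSectorCount_perturbed :
    ∀ μ₁ μ₂ cS : ℝ, -4 < μ₁ → μ₁ ≤ μ₂ → μ₂ < 0 → 0 ≤ cS → ∃ K : ℝ, 0 < K ∧ ∀ μ ∈ Set.Icc μ₁ μ₂, ∀ (n : ℕ) (G : Fin 2 → ℤ) (P₀ : Fin 2 → ℝ),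
      ∀ E : (Fin 2 → ℝ) → ℝ, (∀ k : Fin 2 → ℝ, (∀ i, |k i| < Real.pi) → |E k - sqDispersion k| ≤ sectorWidth n / 2) →
      (((Finset.univ : Finset (Fin (sectorCount n) × Fin (sectorCount n) × Fin (sectorCount n))).filter (fun ω : Fin (sectorCount n) × Fin (sectorCount n) × Fin (sectorCount n) =>
        ∃ k : Fin 3 → Fin 2 → ℝ, (∀ j i, |k j i| < Real.pi) ∧ (∀ j, |E (k j) - μ| ≤ sectorWidth n / 2) ∧
          sectorIndex n (Complex.arg (⟨k 0 0, k 0 1⟩ : ℂ)) = (ω.1 : ℕ) ∧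
          sectorIndex n (Complex.arg (⟨k 1 0, k 1 1⟩ : ℂ)) = (ω.2.1 : ℕ) ∧
          sectorIndex n (Complex.arg (⟨k 2 0, k 2 1⟩ : ℂ)) = (ω.2.2 : ℕ) ∧
          (∀ i, |P₀ i + ∑ j, k j i - 2 * Real.pi * (G i : ℝ)| ≤ cS * sectorWidth n))).card : ℝ) ≤ K * 2 ^ n * ((n : ℝ) + 1) := by
  intro μ₁ μ₂ cS hμ₁ h12 hμ₂ hc
  obtain ⟨K, hK, h⟩ := offsetSectorCount_slack μ₁ μ₂ cS hμ₁ h12 hμ₂ hc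
  refine ⟨K, hK, fun μ hμ n G P₀ E hE => le_trans ?_ (h μ hμ n G P₀)⟩
  exact_mod_cast Finset.card_le_card (Finset.monotone_filter_right _ fun ω _ hω => by
    obtain ⟨k, hk, hsh, h0, h1, h2, hsum⟩ := hω
    refine ⟨k, hk, fun j => ?_, h0, h1, h2, hsum⟩
    have := shell_of_perturbed (hE (k j) (hk j)) (hsh j)
    linarith [this])

end Summit.HubbardSuperconductivity.HubbardSuperconductivity.Theorems
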